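import Summits.HodgeConjecture.HodgeConjecture.Theorems.HodgeLocusCensusUnitColumnHexagon

/-!
# Hodge locus census — the hexagon of the census `p`-complex is exact (PROBE 34)

certified instances and evidence bearing on the general Hodge conjecture; no claim.  Theorem-only helper sheet of the unit-column line over
anchor 362 = PROBE 33 `…UnitColumnHexagon` (codegree transport, `ker_le_ker`, `map_range_eq`, `map_ker_eq_inf`) and, through it, anchor 351 = PROBE 30
`…UnitColumnChain` (chain law `chain_law`, census complex `range_le_ker_of_prime_le`); nothing here is a statement about Hodge loci.

WHAT.  `K` a field; `M_y(S → L)` = PROBE 30's multiplicity matrix of `×q^y` on `A = K[x₁,…,x_k]/(xᵢ^{e+2})` between codegrees `S` (rows) and `L`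
(columns), row vectors act by `Matrix.vecMulLinear`; `X`, `J` are FREE codegrees, `Ja := J + a(e+1)`.  The census homology
    `H_(y)(L ← S) := leftker M_y(L → L + y(e+1)) ⧸ rowspace M_{p−y}(S → L)`      (typed `↥ker ⧸ Submodule.comap ker.subtype range`)
is anchor 355's / PROBE 33's subquotient.  For an `N`-complex, `d^N = 0`, `a + b ≤ N`, the two hexagon sequences
    (i-then-d) `H_(a)(J) →(incl) H_(a+b)(J) →(·d^a) H_(b)(Ja)`,   (d-then-i) `H_(a+b)(J) →(·d^a) H_(b)(Ja) →(incl) H_(N−a)(Ja)`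
are EXACT (M. Dubois-Violette, «d^N = 0», K-Theory 14 (1998) 371–404, doi:10.1023/a:1007786403736 = arXiv:q-alg/9710021, LEMMA 1;
M. M. Kapranov, arXiv:q-alg/9611005, Thm 1.3 — context only).  PROBE 33 proved the two DIMENSION shadows (SUB)/(MID); this sheet proves EXACTNESS
ITSELF for the census `p`-complex `d = ×q`, `N = p = a + b + c`, as identities of submodules — first in the ambient row space `K^{codeg J}`, then
inside the kernels, then literally in the typed homology modules — and the resulting EXACT dimension count at the node `H_(a+b)`:
  §1 (EX-i·d) `ker_inf_comap_eq_sup` — for `a + b + c = p` (char `K` = `p`) and all `k e X J`: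
        `leftker M_(a+b)(J →) ⊓ (×M_a)⁻¹ rowspace M_(c+a)(X → Ja) = leftker M_a(J →) ⊔ rowspace M_c(X → J)`
     («a cycle for `q^(a+b)` whose image under `×q^a` bounds is a `q^a`-cycle plus a boundary» — exactness of (i-then-d) before passing to classes);
     `comap_subtype_comap_eq` — the same read inside `leftker M_(a+b)`;
  §2 (EX-d·i) `comap_subtype_map_ker_eq` — ANY field, all `k e a b J`: inside `leftker M_b(Ja →)`, the image `(leftker M_(a+b)(J →))·M_a` and the
     row space of `M_a(J → Ja)` have the same trace (= PROBE 33 `map_ker_eq_inf` read inside the kernel: exactness of (d-then-i) for every denominator);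
  §3 IN THE HOMOLOGY MODULES (`mkQ` = the class map of the typed quotient): (EX-H1) `map_mkQ_ker_eq_map_mkQ_comap` — in `H_(a+b)(J ← X)` the classes of
     `leftker M_a` (= the image of `H_(a)(J ← ·) → H_(a+b)(J ← X)`) are exactly the classes `[x]` with `x·M_a ∈ rowspace M_(c+a)(X → Ja)` (= the kernel of
     `[x] ↦ [x·M_a] : H_(a+b)(J ← X) → H_(b)(Ja ← X)`); the companion statement in `H_(b)(Ja ← X)` (image of `[x] ↦ [x·M_a]` = classes of
     `rowspace M_a(J → Ja)` = kernel of `H_(b)(Ja ← X) → H_(b+c)(Ja ← J)`) is §2 pushed forward by the class map and is not restated;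
  §4 (EX-dim) `finrank_range_incl_add_finrank_range_pow_eq` — for `a + b + c = p`:
        `dim (classes of leftker M_a in H_(a+b)(J ← X)) + dim (classes of (leftker M_(a+b))·M_a in H_(b)(Ja ← X)) = dim H_(a+b)(J ← X)`,
     i.e. `dim H_(a+b) = rank(i_*) + rank(d^a_*)` — rank–nullity for the induced map `Submodule.mapQ` of `×M_a` between the two typed homology modules
     together with (EX-H1); PROBE 33 (SUB) is its inequality shadow (`rank(i_*) ≤ dim H_(a)`, `rank(d^a_*) ≤ dim H_(b)`).
RELATION TO THE LINE.  Statements are on anchor 351's matrices verbatim at free codegrees (an arriving matrix `M_y(S → L)` with `S + y(e+1) ≠ L` is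
the zero matrix, PROBE 30); the only hypothesis is `a + b + c = p` where the census complex (CX-range) is needed (§1, (EX-H1), §4); §2 holds over
any field.  Nothing is imported from anchors 345/349/355 or PROBE 32.
NUMERICS FIRST (owner, file-backed under `HOME/pub-hlocus-ivhs-2/gen58/probe34/`): `num34.py` checks §1 as an identity of row spaces over `GF(p)`
(both sides spanned and compared by rank), §2 likewise, and §4 as the integer identity `dim H_(a+b)(J ← X) = [dim(leftker M_a + rowspace M_c) −
rank M_c(X → J)] + [dim(rowspace M_a ⊓ leftker M_b) − rank M_(c+a)(X → Ja)]` on literal census matrices over the whole typed range; counts and the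
kit job id are in the READY line.
LITERATURE (context only; nothing imported or minted): as displayed.  No literature fact is used as a hypothesis.
EVIDENCE CLASS: kernel theorems about the census matrices; no census number changes; nothing here asserts anything about the Hodge conjecture.

Import: anchor 362 = PROBE 33 `…Theorems.HodgeLocusCensusUnitColumnHexagon` BY NAME (hence anchor 351, anchor 229 and gen 31's `colR`); theorem-only,
definition-free; Mathlib by name: `Submodule.mem_inf`, `Submodule.mem_sup`, `Submodule.mem_comap`, `Submodule.mem_map_of_mem`, `Submodule.comap_inf`,
`Submodule.comap_subtype_self`, `Submodule.map_comap_subtype`, `Submodule.map_sup`, `Submodule.map_injective_of_injective`, `Submodule.injective_subtype`,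
`Submodule.mkQ_map_self`, `Submodule.mapQ`, `Submodule.range_mapQ`, `Submodule.ker_mapQ`, `Submodule.comap_comp`, `LinearMap.codRestrict`,
`LinearMap.range_codRestrict`, `LinearMap.comap_codRestrict`, `LinearMap.range_comp`, `Submodule.range_subtype`, `LinearMap.finrank_range_add_finrank_ker`,
`LinearEquiv.ofEq`, `LinearEquiv.finrank_eq`, `Matrix.vecMul_vecMul`.
-/

set_option linter.dupNamespace false
set_option autoImplicit false

namespace Summit.HodgeConjecture.HodgeConjecture.HodgeLocus.Census.UnitColumnHexagonExact

open Summit.HodgeConjecture.HodgeConjecture.HodgeLocus.Census.ModelNonJumpC1All (colR)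
open Summit.HodgeConjecture.HodgeConjecture.HodgeLocus.Census.UnitColumnChain (chain_law range_le_ker_of_prime_le)
open Summit.HodgeConjecture.HodgeConjecture.HodgeLocus.Census.UnitColumnHexagon (ker_eq_ker_of_eq ker_le_ker map_range_eq map_ker_eq_inf)

/-! ## §1 (EX-i·d) exactness of `H_(a) → H_(a+b) → H_(b)` as a submodule identity in the ambient row space -/

/-- **(EX-i·d)** for `a + b + c = p` and free codegrees `X`, `J` (`Ja = J + a(e+1)`):
`leftker M_(a+b)(J → J + (a+b)(e+1)) ⊓ (×M_a(J → Ja))⁻¹ (rowspace M_(c+a)(X → Ja)) = leftker M_a(J → Ja) ⊔ rowspace M_c(X → J)`. -/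
theorem ker_inf_comap_eq_sup (K : Type*) [Field K] (p : ℕ) [CharP K p] (hp : p.Prime) (k e a b c X J : ℕ) (habc : a + b + c = p) :
    LinearMap.ker (Matrix.vecMulLinear
      (Matrix.of fun (v : {v : Fin k → Fin (e + 2) // (∑ i, (v i : ℕ)) + J = k * (e + 1)})
          (m : {m : Fin k → Fin (e + 2) // (∑ i, (m i : ℕ)) + (J + (a + b) * (e + 1)) = k * (e + 1)}) =>
        ((((List.flatMap (colR (e + 3)))^[a + b] [List.ofFn (fun i => (m.1 i : ℕ))]).count (List.ofFn (fun i => (v.1 i : ℕ))) : ℕ) : K))) ⊓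
    Submodule.comap (Matrix.vecMulLinear
      (Matrix.of fun (v : {v : Fin k → Fin (e + 2) // (∑ i, (v i : ℕ)) + J = k * (e + 1)})
          (m : {m : Fin k → Fin (e + 2) // (∑ i, (m i : ℕ)) + (J + a * (e + 1)) = k * (e + 1)}) =>
        ((((List.flatMap (colR (e + 3)))^[a] [List.ofFn (fun i => (m.1 i : ℕ))]).count (List.ofFn (fun i => (v.1 i : ℕ))) : ℕ) : K)))
      (LinearMap.range (Matrix.vecMulLinear
      (Matrix.of fun (v : {v : Fin k → Fin (e + 2) // (∑ i, (v i : ℕ)) + X = k * (e + 1)})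
          (m : {m : Fin k → Fin (e + 2) // (∑ i, (m i : ℕ)) + (J + a * (e + 1)) = k * (e + 1)}) =>
        ((((List.flatMap (colR (e + 3)))^[c + a] [List.ofFn (fun i => (m.1 i : ℕ))]).count (List.ofFn (fun i => (v.1 i : ℕ))) : ℕ) : K)))) =
    LinearMap.ker (Matrix.vecMulLinear
      (Matrix.of fun (v : {v : Fin k → Fin (e + 2) // (∑ i, (v i : ℕ)) + J = k * (e + 1)})
          (m : {m : Fin k → Fin (e + 2) // (∑ i, (m i : ℕ)) + (J + a * (e + 1)) = k * (e + 1)}) =>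
        ((((List.flatMap (colR (e + 3)))^[a] [List.ofFn (fun i => (m.1 i : ℕ))]).count (List.ofFn (fun i => (v.1 i : ℕ))) : ℕ) : K))) ⊔
    LinearMap.range (Matrix.vecMulLinear
      (Matrix.of fun (v : {v : Fin k → Fin (e + 2) // (∑ i, (v i : ℕ)) + X = k * (e + 1)})
          (m : {m : Fin k → Fin (e + 2) // (∑ i, (m i : ℕ)) + J = k * (e + 1)}) =>
        ((((List.flatMap (colR (e + 3)))^[c] [List.ofFn (fun i => (m.1 i : ℕ))]).count (List.ofFn (fun i => (v.1 i : ℕ))) : ℕ) : K))) := by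
  have f1 := ker_le_ker K k e a b J (J + a * (e + 1))
  rw [ker_eq_ker_of_eq K k e (a + b) J (show J + a * (e + 1) + b * (e + 1) = J + (a + b) * (e + 1) by ring)] at f1
  have f2 := range_le_ker_of_prime_le K p hp k e c (a + b) X J (by omega)
  have mr := map_range_eq K k e c a X J
  apply le_antisymm
  · intro x hx
    rw [Submodule.mem_inf, Submodule.mem_comap, LinearMap.mem_range] at hx
    obtain ⟨-, w, hw⟩ := hx
    rw [Matrix.vecMulLinear_apply, Matrix.vecMulLinear_apply] at hw
    rw [Submodule.mem_sup]
    refine ⟨x - Matrix.vecMul w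
      (Matrix.of fun (v : {v : Fin k → Fin (e + 2) // (∑ i, (v i : ℕ)) + X = k * (e + 1)})
          (m : {m : Fin k → Fin (e + 2) // (∑ i, (m i : ℕ)) + J = k * (e + 1)}) =>
        ((((List.flatMap (colR (e + 3)))^[c] [List.ofFn (fun i => (m.1 i : ℕ))]).count (List.ofFn (fun i => (v.1 i : ℕ))) : ℕ) : K)), ?_, Matrix.vecMul w
      (Matrix.of fun (v : {v : Fin k → Fin (e + 2) // (∑ i, (v i : ℕ)) + X = k * (e + 1)})
          (m : {m : Fin k → Fin (e + 2) // (∑ i, (m i : ℕ)) + J = k * (e + 1)}) =>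
        ((((List.flatMap (colR (e + 3)))^[c] [List.ofFn (fun i => (m.1 i : ℕ))]).count (List.ofFn (fun i => (v.1 i : ℕ))) : ℕ) : K)),
      ⟨w, rfl⟩, sub_add_cancel _ _⟩
    rw [LinearMap.mem_ker, map_sub, Matrix.vecMulLinear_apply, Matrix.vecMulLinear_apply, Matrix.vecMul_vecMul,
      chain_law K k e c a X J, hw, sub_self]
  · refine sup_le (fun x hx => ?_) (fun y hy => ?_)
    · refine Submodule.mem_inf.mpr ⟨f1 hx, ?_⟩
      rw [LinearMap.mem_ker] at hx
      rw [Submodule.mem_comap, hx]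
      exact Submodule.zero_mem _
    · refine Submodule.mem_inf.mpr ⟨f2 hy, ?_⟩
      rw [Submodule.mem_comap, ← mr]
      exact Submodule.mem_map_of_mem hy

/-- (EX-i·d) read inside the big kernel: in `↥leftker M_(a+b)(J →)` the preimage of `(×M_a)⁻¹ rowspace M_(c+a)(X → Ja)` is the preimage of
`leftker M_a ⊔ rowspace M_c(X → J)`. -/
theorem comap_subtype_comap_eq (K : Type*) [Field K] (p : ℕ) [CharP K p] (hp : p.Prime) (k e a b c X J : ℕ) (habc : a + b + c = p) :
    Submodule.comap (LinearMap.ker (Matrix.vecMulLinear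
      (Matrix.of fun (v : {v : Fin k → Fin (e + 2) // (∑ i, (v i : ℕ)) + J = k * (e + 1)})
          (m : {m : Fin k → Fin (e + 2) // (∑ i, (m i : ℕ)) + (J + (a + b) * (e + 1)) = k * (e + 1)}) =>
        ((((List.flatMap (colR (e + 3)))^[a + b] [List.ofFn (fun i => (m.1 i : ℕ))]).count (List.ofFn (fun i => (v.1 i : ℕ))) : ℕ) : K)))).subtype
      (Submodule.comap (Matrix.vecMulLinear
      (Matrix.of fun (v : {v : Fin k → Fin (e + 2) // (∑ i, (v i : ℕ)) + J = k * (e + 1)})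
          (m : {m : Fin k → Fin (e + 2) // (∑ i, (m i : ℕ)) + (J + a * (e + 1)) = k * (e + 1)}) =>
        ((((List.flatMap (colR (e + 3)))^[a] [List.ofFn (fun i => (m.1 i : ℕ))]).count (List.ofFn (fun i => (v.1 i : ℕ))) : ℕ) : K)))
        (LinearMap.range (Matrix.vecMulLinear
      (Matrix.of fun (v : {v : Fin k → Fin (e + 2) // (∑ i, (v i : ℕ)) + X = k * (e + 1)})
          (m : {m : Fin k → Fin (e + 2) // (∑ i, (m i : ℕ)) + (J + a * (e + 1)) = k * (e + 1)}) =>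
        ((((List.flatMap (colR (e + 3)))^[c + a] [List.ofFn (fun i => (m.1 i : ℕ))]).count (List.ofFn (fun i => (v.1 i : ℕ))) : ℕ) : K))))) =
    Submodule.comap (LinearMap.ker (Matrix.vecMulLinear
      (Matrix.of fun (v : {v : Fin k → Fin (e + 2) // (∑ i, (v i : ℕ)) + J = k * (e + 1)})
          (m : {m : Fin k → Fin (e + 2) // (∑ i, (m i : ℕ)) + (J + (a + b) * (e + 1)) = k * (e + 1)}) =>
        ((((List.flatMap (colR (e + 3)))^[a + b] [List.ofFn (fun i => (m.1 i : ℕ))]).count (List.ofFn (fun i => (v.1 i : ℕ))) : ℕ) : K)))).subtype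
      (LinearMap.ker (Matrix.vecMulLinear
      (Matrix.of fun (v : {v : Fin k → Fin (e + 2) // (∑ i, (v i : ℕ)) + J = k * (e + 1)})
          (m : {m : Fin k → Fin (e + 2) // (∑ i, (m i : ℕ)) + (J + a * (e + 1)) = k * (e + 1)}) =>
        ((((List.flatMap (colR (e + 3)))^[a] [List.ofFn (fun i => (m.1 i : ℕ))]).count (List.ofFn (fun i => (v.1 i : ℕ))) : ℕ) : K))) ⊔
      LinearMap.range (Matrix.vecMulLinear
      (Matrix.of fun (v : {v : Fin k → Fin (e + 2) // (∑ i, (v i : ℕ)) + X = k * (e + 1)})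
          (m : {m : Fin k → Fin (e + 2) // (∑ i, (m i : ℕ)) + J = k * (e + 1)}) =>
        ((((List.flatMap (colR (e + 3)))^[c] [List.ofFn (fun i => (m.1 i : ℕ))]).count (List.ofFn (fun i => (v.1 i : ℕ))) : ℕ) : K)))) := by
  rw [← ker_inf_comap_eq_sup K p hp k e a b c X J habc, Submodule.comap_inf, Submodule.comap_subtype_self, top_inf_eq]

/-! ## §2 (EX-d·i) exactness of `H_(a+b) → H_(b) → H_(p−a)` inside the kernel (any field) -/

/-- **(EX-d·i)** (any field): inside `↥leftker M_b(Ja → Ja + b(e+1))` the preimage of `(leftker M_(a+b)(J →))·M_a` equals the preimage of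
`rowspace M_a(J → Ja)` — PROBE 33 `map_ker_eq_inf` read inside the kernel. -/
theorem comap_subtype_map_ker_eq (K : Type*) [Field K] (k e a b J : ℕ) :
    Submodule.comap (LinearMap.ker (Matrix.vecMulLinear
      (Matrix.of fun (v : {v : Fin k → Fin (e + 2) // (∑ i, (v i : ℕ)) + (J + a * (e + 1)) = k * (e + 1)})
          (m : {m : Fin k → Fin (e + 2) // (∑ i, (m i : ℕ)) + (J + a * (e + 1) + b * (e + 1)) = k * (e + 1)}) =>
        ((((List.flatMap (colR (e + 3)))^[b] [List.ofFn (fun i => (m.1 i : ℕ))]).count (List.ofFn (fun i => (v.1 i : ℕ))) : ℕ) : K)))).subtype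
      (Submodule.map (Matrix.vecMulLinear
      (Matrix.of fun (v : {v : Fin k → Fin (e + 2) // (∑ i, (v i : ℕ)) + J = k * (e + 1)})
          (m : {m : Fin k → Fin (e + 2) // (∑ i, (m i : ℕ)) + (J + a * (e + 1)) = k * (e + 1)}) =>
        ((((List.flatMap (colR (e + 3)))^[a] [List.ofFn (fun i => (m.1 i : ℕ))]).count (List.ofFn (fun i => (v.1 i : ℕ))) : ℕ) : K)))
        (LinearMap.ker (Matrix.vecMulLinear
      (Matrix.of fun (v : {v : Fin k → Fin (e + 2) // (∑ i, (v i : ℕ)) + J = k * (e + 1)})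
          (m : {m : Fin k → Fin (e + 2) // (∑ i, (m i : ℕ)) + (J + (a + b) * (e + 1)) = k * (e + 1)}) =>
        ((((List.flatMap (colR (e + 3)))^[a + b] [List.ofFn (fun i => (m.1 i : ℕ))]).count (List.ofFn (fun i => (v.1 i : ℕ))) : ℕ) : K))))) =
    Submodule.comap (LinearMap.ker (Matrix.vecMulLinear
      (Matrix.of fun (v : {v : Fin k → Fin (e + 2) // (∑ i, (v i : ℕ)) + (J + a * (e + 1)) = k * (e + 1)})
          (m : {m : Fin k → Fin (e + 2) // (∑ i, (m i : ℕ)) + (J + a * (e + 1) + b * (e + 1)) = k * (e + 1)}) =>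
        ((((List.flatMap (colR (e + 3)))^[b] [List.ofFn (fun i => (m.1 i : ℕ))]).count (List.ofFn (fun i => (v.1 i : ℕ))) : ℕ) : K)))).subtype
      (LinearMap.range (Matrix.vecMulLinear
      (Matrix.of fun (v : {v : Fin k → Fin (e + 2) // (∑ i, (v i : ℕ)) + J = k * (e + 1)})
          (m : {m : Fin k → Fin (e + 2) // (∑ i, (m i : ℕ)) + (J + a * (e + 1)) = k * (e + 1)}) =>
        ((((List.flatMap (colR (e + 3)))^[a] [List.ofFn (fun i => (m.1 i : ℕ))]).count (List.ofFn (fun i => (v.1 i : ℕ))) : ℕ) : K)))) := by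
  rw [map_ker_eq_inf K k e a b J, Submodule.comap_inf, Submodule.comap_subtype_self, inf_top_eq]

/-! ## §3 exactness in the typed homology modules -/

/-- **(EX-H1)** for `a + b + c = p`: in `H_(a+b)(J ← X) = ↥leftker M_(a+b) ⧸ comap … (rowspace M_c(X → J))` the classes of `leftker M_a(J → Ja)`
(the image of `H_(a)`) are exactly the classes `[x]` with `x·M_a ∈ rowspace M_(c+a)(X → Ja)` (the kernel of `[x] ↦ [x·M_a]` into `H_(b)(Ja ← X)`). -/
theorem map_mkQ_ker_eq_map_mkQ_comap (K : Type*) [Field K] (p : ℕ) [CharP K p] (hp : p.Prime) (k e a b c X J : ℕ) (habc : a + b + c = p) :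
    Submodule.map (Submodule.comap (LinearMap.ker (Matrix.vecMulLinear
      (Matrix.of fun (v : {v : Fin k → Fin (e + 2) // (∑ i, (v i : ℕ)) + J = k * (e + 1)})
          (m : {m : Fin k → Fin (e + 2) // (∑ i, (m i : ℕ)) + (J + (a + b) * (e + 1)) = k * (e + 1)}) =>
        ((((List.flatMap (colR (e + 3)))^[a + b] [List.ofFn (fun i => (m.1 i : ℕ))]).count (List.ofFn (fun i => (v.1 i : ℕ))) : ℕ) : K)))).subtype
        (LinearMap.range (Matrix.vecMulLinear
      (Matrix.of fun (v : {v : Fin k → Fin (e + 2) // (∑ i, (v i : ℕ)) + X = k * (e + 1)})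
          (m : {m : Fin k → Fin (e + 2) // (∑ i, (m i : ℕ)) + J = k * (e + 1)}) =>
        ((((List.flatMap (colR (e + 3)))^[c] [List.ofFn (fun i => (m.1 i : ℕ))]).count (List.ofFn (fun i => (v.1 i : ℕ))) : ℕ) : K))))).mkQ
      (Submodule.comap (LinearMap.ker (Matrix.vecMulLinear
      (Matrix.of fun (v : {v : Fin k → Fin (e + 2) // (∑ i, (v i : ℕ)) + J = k * (e + 1)})
          (m : {m : Fin k → Fin (e + 2) // (∑ i, (m i : ℕ)) + (J + (a + b) * (e + 1)) = k * (e + 1)}) =>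
        ((((List.flatMap (colR (e + 3)))^[a + b] [List.ofFn (fun i => (m.1 i : ℕ))]).count (List.ofFn (fun i => (v.1 i : ℕ))) : ℕ) : K)))).subtype
        (LinearMap.ker (Matrix.vecMulLinear
      (Matrix.of fun (v : {v : Fin k → Fin (e + 2) // (∑ i, (v i : ℕ)) + J = k * (e + 1)})
          (m : {m : Fin k → Fin (e + 2) // (∑ i, (m i : ℕ)) + (J + a * (e + 1)) = k * (e + 1)}) =>
        ((((List.flatMap (colR (e + 3)))^[a] [List.ofFn (fun i => (m.1 i : ℕ))]).count (List.ofFn (fun i => (v.1 i : ℕ))) : ℕ) : K))))) =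
    Submodule.map (Submodule.comap (LinearMap.ker (Matrix.vecMulLinear
      (Matrix.of fun (v : {v : Fin k → Fin (e + 2) // (∑ i, (v i : ℕ)) + J = k * (e + 1)})
          (m : {m : Fin k → Fin (e + 2) // (∑ i, (m i : ℕ)) + (J + (a + b) * (e + 1)) = k * (e + 1)}) =>
        ((((List.flatMap (colR (e + 3)))^[a + b] [List.ofFn (fun i => (m.1 i : ℕ))]).count (List.ofFn (fun i => (v.1 i : ℕ))) : ℕ) : K)))).subtype
        (LinearMap.range (Matrix.vecMulLinear
      (Matrix.of fun (v : {v : Fin k → Fin (e + 2) // (∑ i, (v i : ℕ)) + X = k * (e + 1)})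
          (m : {m : Fin k → Fin (e + 2) // (∑ i, (m i : ℕ)) + J = k * (e + 1)}) =>
        ((((List.flatMap (colR (e + 3)))^[c] [List.ofFn (fun i => (m.1 i : ℕ))]).count (List.ofFn (fun i => (v.1 i : ℕ))) : ℕ) : K))))).mkQ
      (Submodule.comap (LinearMap.ker (Matrix.vecMulLinear
      (Matrix.of fun (v : {v : Fin k → Fin (e + 2) // (∑ i, (v i : ℕ)) + J = k * (e + 1)})
          (m : {m : Fin k → Fin (e + 2) // (∑ i, (m i : ℕ)) + (J + (a + b) * (e + 1)) = k * (e + 1)}) =>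
        ((((List.flatMap (colR (e + 3)))^[a + b] [List.ofFn (fun i => (m.1 i : ℕ))]).count (List.ofFn (fun i => (v.1 i : ℕ))) : ℕ) : K)))).subtype
        (Submodule.comap (Matrix.vecMulLinear
      (Matrix.of fun (v : {v : Fin k → Fin (e + 2) // (∑ i, (v i : ℕ)) + J = k * (e + 1)})
          (m : {m : Fin k → Fin (e + 2) // (∑ i, (m i : ℕ)) + (J + a * (e + 1)) = k * (e + 1)}) =>
        ((((List.flatMap (colR (e + 3)))^[a] [List.ofFn (fun i => (m.1 i : ℕ))]).count (List.ofFn (fun i => (v.1 i : ℕ))) : ℕ) : K)))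
          (LinearMap.range (Matrix.vecMulLinear
      (Matrix.of fun (v : {v : Fin k → Fin (e + 2) // (∑ i, (v i : ℕ)) + X = k * (e + 1)})
          (m : {m : Fin k → Fin (e + 2) // (∑ i, (m i : ℕ)) + (J + a * (e + 1)) = k * (e + 1)}) =>
        ((((List.flatMap (colR (e + 3)))^[c + a] [List.ofFn (fun i => (m.1 i : ℕ))]).count (List.ofFn (fun i => (v.1 i : ℕ))) : ℕ) : K)))))) := by
  have f1 := ker_le_ker K k e a b J (J + a * (e + 1))
  rw [ker_eq_ker_of_eq K k e (a + b) J (show J + a * (e + 1) + b * (e + 1) = J + (a + b) * (e + 1) by ring)] at f1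
  have f2 := range_le_ker_of_prime_le K p hp k e c (a + b) X J (by omega)
  have hd : Submodule.comap (LinearMap.ker (Matrix.vecMulLinear
      (Matrix.of fun (v : {v : Fin k → Fin (e + 2) // (∑ i, (v i : ℕ)) + J = k * (e + 1)})
          (m : {m : Fin k → Fin (e + 2) // (∑ i, (m i : ℕ)) + (J + (a + b) * (e + 1)) = k * (e + 1)}) =>
        ((((List.flatMap (colR (e + 3)))^[a + b] [List.ofFn (fun i => (m.1 i : ℕ))]).count (List.ofFn (fun i => (v.1 i : ℕ))) : ℕ) : K)))).subtype
      (LinearMap.ker (Matrix.vecMulLinear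
      (Matrix.of fun (v : {v : Fin k → Fin (e + 2) // (∑ i, (v i : ℕ)) + J = k * (e + 1)})
          (m : {m : Fin k → Fin (e + 2) // (∑ i, (m i : ℕ)) + (J + a * (e + 1)) = k * (e + 1)}) =>
        ((((List.flatMap (colR (e + 3)))^[a] [List.ofFn (fun i => (m.1 i : ℕ))]).count (List.ofFn (fun i => (v.1 i : ℕ))) : ℕ) : K))) ⊔
      LinearMap.range (Matrix.vecMulLinear
      (Matrix.of fun (v : {v : Fin k → Fin (e + 2) // (∑ i, (v i : ℕ)) + X = k * (e + 1)})
          (m : {m : Fin k → Fin (e + 2) // (∑ i, (m i : ℕ)) + J = k * (e + 1)}) =>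
        ((((List.flatMap (colR (e + 3)))^[c] [List.ofFn (fun i => (m.1 i : ℕ))]).count (List.ofFn (fun i => (v.1 i : ℕ))) : ℕ) : K)))) =
    Submodule.comap (LinearMap.ker (Matrix.vecMulLinear
      (Matrix.of fun (v : {v : Fin k → Fin (e + 2) // (∑ i, (v i : ℕ)) + J = k * (e + 1)})
          (m : {m : Fin k → Fin (e + 2) // (∑ i, (m i : ℕ)) + (J + (a + b) * (e + 1)) = k * (e + 1)}) =>
        ((((List.flatMap (colR (e + 3)))^[a + b] [List.ofFn (fun i => (m.1 i : ℕ))]).count (List.ofFn (fun i => (v.1 i : ℕ))) : ℕ) : K)))).subtype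
      (LinearMap.ker (Matrix.vecMulLinear
      (Matrix.of fun (v : {v : Fin k → Fin (e + 2) // (∑ i, (v i : ℕ)) + J = k * (e + 1)})
          (m : {m : Fin k → Fin (e + 2) // (∑ i, (m i : ℕ)) + (J + a * (e + 1)) = k * (e + 1)}) =>
        ((((List.flatMap (colR (e + 3)))^[a] [List.ofFn (fun i => (m.1 i : ℕ))]).count (List.ofFn (fun i => (v.1 i : ℕ))) : ℕ) : K)))) ⊔
    Submodule.comap (LinearMap.ker (Matrix.vecMulLinear
      (Matrix.of fun (v : {v : Fin k → Fin (e + 2) // (∑ i, (v i : ℕ)) + J = k * (e + 1)})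
          (m : {m : Fin k → Fin (e + 2) // (∑ i, (m i : ℕ)) + (J + (a + b) * (e + 1)) = k * (e + 1)}) =>
        ((((List.flatMap (colR (e + 3)))^[a + b] [List.ofFn (fun i => (m.1 i : ℕ))]).count (List.ofFn (fun i => (v.1 i : ℕ))) : ℕ) : K)))).subtype
        (LinearMap.range (Matrix.vecMulLinear
      (Matrix.of fun (v : {v : Fin k → Fin (e + 2) // (∑ i, (v i : ℕ)) + X = k * (e + 1)})
          (m : {m : Fin k → Fin (e + 2) // (∑ i, (m i : ℕ)) + J = k * (e + 1)}) =>
        ((((List.flatMap (colR (e + 3)))^[c] [List.ofFn (fun i => (m.1 i : ℕ))]).count (List.ofFn (fun i => (v.1 i : ℕ))) : ℕ) : K)))) := by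
    refine Submodule.map_injective_of_injective (Submodule.injective_subtype _) ?_
    rw [Submodule.map_sup, Submodule.map_comap_subtype, Submodule.map_comap_subtype, Submodule.map_comap_subtype,
      inf_eq_right.mpr (sup_le f1 f2), inf_eq_right.mpr f1, inf_eq_right.mpr f2]
  rw [comap_subtype_comap_eq K p hp k e a b c X J habc, hd, Submodule.map_sup, Submodule.mkQ_map_self, sup_bot_eq]

/-! ## §4 (EX-dim) the exact dimension count at the node `H_(a+b)` -/

/-- **(EX-dim)** for `a + b + c = p`: `dim (image of H_(a)(J ← ·) in H_(a+b)(J ← X)) + dim (image of H_(a+b)(J ← X) in H_(b)(Ja ← X)) =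
dim H_(a+b)(J ← X)` — rank–nullity for the induced map of `×M_a` on the typed homology modules plus (EX-H1). -/
theorem finrank_range_incl_add_finrank_range_pow_eq (K : Type*) [Field K] (p : ℕ) [CharP K p] (hp : p.Prime) (k e a b c X J : ℕ)
    (habc : a + b + c = p) :
    Module.finrank K ↥(Submodule.map (Submodule.comap (LinearMap.ker (Matrix.vecMulLinear
      (Matrix.of fun (v : {v : Fin k → Fin (e + 2) // (∑ i, (v i : ℕ)) + J = k * (e + 1)})
          (m : {m : Fin k → Fin (e + 2) // (∑ i, (m i : ℕ)) + (J + (a + b) * (e + 1)) = k * (e + 1)}) =>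
        ((((List.flatMap (colR (e + 3)))^[a + b] [List.ofFn (fun i => (m.1 i : ℕ))]).count (List.ofFn (fun i => (v.1 i : ℕ))) : ℕ) : K)))).subtype
        (LinearMap.range (Matrix.vecMulLinear
      (Matrix.of fun (v : {v : Fin k → Fin (e + 2) // (∑ i, (v i : ℕ)) + X = k * (e + 1)})
          (m : {m : Fin k → Fin (e + 2) // (∑ i, (m i : ℕ)) + J = k * (e + 1)}) =>
        ((((List.flatMap (colR (e + 3)))^[c] [List.ofFn (fun i => (m.1 i : ℕ))]).count (List.ofFn (fun i => (v.1 i : ℕ))) : ℕ) : K))))).mkQ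
      (Submodule.comap (LinearMap.ker (Matrix.vecMulLinear
      (Matrix.of fun (v : {v : Fin k → Fin (e + 2) // (∑ i, (v i : ℕ)) + J = k * (e + 1)})
          (m : {m : Fin k → Fin (e + 2) // (∑ i, (m i : ℕ)) + (J + (a + b) * (e + 1)) = k * (e + 1)}) =>
        ((((List.flatMap (colR (e + 3)))^[a + b] [List.ofFn (fun i => (m.1 i : ℕ))]).count (List.ofFn (fun i => (v.1 i : ℕ))) : ℕ) : K)))).subtype
        (LinearMap.ker (Matrix.vecMulLinear
      (Matrix.of fun (v : {v : Fin k → Fin (e + 2) // (∑ i, (v i : ℕ)) + J = k * (e + 1)})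
          (m : {m : Fin k → Fin (e + 2) // (∑ i, (m i : ℕ)) + (J + a * (e + 1)) = k * (e + 1)}) =>
        ((((List.flatMap (colR (e + 3)))^[a] [List.ofFn (fun i => (m.1 i : ℕ))]).count (List.ofFn (fun i => (v.1 i : ℕ))) : ℕ) : K)))))) +
    Module.finrank K ↥(Submodule.map (Submodule.comap (LinearMap.ker (Matrix.vecMulLinear
      (Matrix.of fun (v : {v : Fin k → Fin (e + 2) // (∑ i, (v i : ℕ)) + (J + a * (e + 1)) = k * (e + 1)})
          (m : {m : Fin k → Fin (e + 2) // (∑ i, (m i : ℕ)) + (J + a * (e + 1) + b * (e + 1)) = k * (e + 1)}) =>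
        ((((List.flatMap (colR (e + 3)))^[b] [List.ofFn (fun i => (m.1 i : ℕ))]).count (List.ofFn (fun i => (v.1 i : ℕ))) : ℕ) : K)))).subtype
        (LinearMap.range (Matrix.vecMulLinear
      (Matrix.of fun (v : {v : Fin k → Fin (e + 2) // (∑ i, (v i : ℕ)) + X = k * (e + 1)})
          (m : {m : Fin k → Fin (e + 2) // (∑ i, (m i : ℕ)) + (J + a * (e + 1)) = k * (e + 1)}) =>
        ((((List.flatMap (colR (e + 3)))^[c + a] [List.ofFn (fun i => (m.1 i : ℕ))]).count (List.ofFn (fun i => (v.1 i : ℕ))) : ℕ) : K))))).mkQ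
      (Submodule.comap (LinearMap.ker (Matrix.vecMulLinear
      (Matrix.of fun (v : {v : Fin k → Fin (e + 2) // (∑ i, (v i : ℕ)) + (J + a * (e + 1)) = k * (e + 1)})
          (m : {m : Fin k → Fin (e + 2) // (∑ i, (m i : ℕ)) + (J + a * (e + 1) + b * (e + 1)) = k * (e + 1)}) =>
        ((((List.flatMap (colR (e + 3)))^[b] [List.ofFn (fun i => (m.1 i : ℕ))]).count (List.ofFn (fun i => (v.1 i : ℕ))) : ℕ) : K)))).subtype
        (Submodule.map (Matrix.vecMulLinear
      (Matrix.of fun (v : {v : Fin k → Fin (e + 2) // (∑ i, (v i : ℕ)) + J = k * (e + 1)})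
          (m : {m : Fin k → Fin (e + 2) // (∑ i, (m i : ℕ)) + (J + a * (e + 1)) = k * (e + 1)}) =>
        ((((List.flatMap (colR (e + 3)))^[a] [List.ofFn (fun i => (m.1 i : ℕ))]).count (List.ofFn (fun i => (v.1 i : ℕ))) : ℕ) : K)))
          (LinearMap.ker (Matrix.vecMulLinear
      (Matrix.of fun (v : {v : Fin k → Fin (e + 2) // (∑ i, (v i : ℕ)) + J = k * (e + 1)})
          (m : {m : Fin k → Fin (e + 2) // (∑ i, (m i : ℕ)) + (J + (a + b) * (e + 1)) = k * (e + 1)}) =>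
        ((((List.flatMap (colR (e + 3)))^[a + b] [List.ofFn (fun i => (m.1 i : ℕ))]).count (List.ofFn (fun i => (v.1 i : ℕ))) : ℕ) : K))))))) =
    Module.finrank K (↥(LinearMap.ker (Matrix.vecMulLinear
      (Matrix.of fun (v : {v : Fin k → Fin (e + 2) // (∑ i, (v i : ℕ)) + J = k * (e + 1)})
          (m : {m : Fin k → Fin (e + 2) // (∑ i, (m i : ℕ)) + (J + (a + b) * (e + 1)) = k * (e + 1)}) =>
        ((((List.flatMap (colR (e + 3)))^[a + b] [List.ofFn (fun i => (m.1 i : ℕ))]).count (List.ofFn (fun i => (v.1 i : ℕ))) : ℕ) : K)))) ⧸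
      Submodule.comap (LinearMap.ker (Matrix.vecMulLinear
      (Matrix.of fun (v : {v : Fin k → Fin (e + 2) // (∑ i, (v i : ℕ)) + J = k * (e + 1)})
          (m : {m : Fin k → Fin (e + 2) // (∑ i, (m i : ℕ)) + (J + (a + b) * (e + 1)) = k * (e + 1)}) =>
        ((((List.flatMap (colR (e + 3)))^[a + b] [List.ofFn (fun i => (m.1 i : ℕ))]).count (List.ofFn (fun i => (v.1 i : ℕ))) : ℕ) : K)))).subtype
        (LinearMap.range (Matrix.vecMulLinear
      (Matrix.of fun (v : {v : Fin k → Fin (e + 2) // (∑ i, (v i : ℕ)) + X = k * (e + 1)})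
          (m : {m : Fin k → Fin (e + 2) // (∑ i, (m i : ℕ)) + J = k * (e + 1)}) =>
        ((((List.flatMap (colR (e + 3)))^[c] [List.ofFn (fun i => (m.1 i : ℕ))]).count (List.ofFn (fun i => (v.1 i : ℕ))) : ℕ) : K))))) := by
  have f4 := range_le_ker_of_prime_le K p hp k e (c + a) b X (J + a * (e + 1)) (by omega)
  have mr := map_range_eq K k e c a X J
  have mk := map_ker_eq_inf K k e a b J
  -- `×M_a` restricted to the big kernel lands in `leftker M_b`
  have hf : ∀ x : ↥(LinearMap.ker (Matrix.vecMulLinear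
      (Matrix.of fun (v : {v : Fin k → Fin (e + 2) // (∑ i, (v i : ℕ)) + J = k * (e + 1)})
          (m : {m : Fin k → Fin (e + 2) // (∑ i, (m i : ℕ)) + (J + (a + b) * (e + 1)) = k * (e + 1)}) =>
        ((((List.flatMap (colR (e + 3)))^[a + b] [List.ofFn (fun i => (m.1 i : ℕ))]).count (List.ofFn (fun i => (v.1 i : ℕ))) : ℕ) : K)))),
      ((Matrix.vecMulLinear
      (Matrix.of fun (v : {v : Fin k → Fin (e + 2) // (∑ i, (v i : ℕ)) + J = k * (e + 1)})
          (m : {m : Fin k → Fin (e + 2) // (∑ i, (m i : ℕ)) + (J + a * (e + 1)) = k * (e + 1)}) =>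
        ((((List.flatMap (colR (e + 3)))^[a] [List.ofFn (fun i => (m.1 i : ℕ))]).count (List.ofFn (fun i => (v.1 i : ℕ))) : ℕ) : K))).comp
        (LinearMap.ker (Matrix.vecMulLinear
      (Matrix.of fun (v : {v : Fin k → Fin (e + 2) // (∑ i, (v i : ℕ)) + J = k * (e + 1)})
          (m : {m : Fin k → Fin (e + 2) // (∑ i, (m i : ℕ)) + (J + (a + b) * (e + 1)) = k * (e + 1)}) =>
        ((((List.flatMap (colR (e + 3)))^[a + b] [List.ofFn (fun i => (m.1 i : ℕ))]).count (List.ofFn (fun i => (v.1 i : ℕ))) : ℕ) : K)))).subtype) x ∈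
      LinearMap.ker (Matrix.vecMulLinear
      (Matrix.of fun (v : {v : Fin k → Fin (e + 2) // (∑ i, (v i : ℕ)) + (J + a * (e + 1)) = k * (e + 1)})
          (m : {m : Fin k → Fin (e + 2) // (∑ i, (m i : ℕ)) + (J + a * (e + 1) + b * (e + 1)) = k * (e + 1)}) =>
        ((((List.flatMap (colR (e + 3)))^[b] [List.ofFn (fun i => (m.1 i : ℕ))]).count (List.ofFn (fun i => (v.1 i : ℕ))) : ℕ) : K))) :=
    fun x => (Submodule.mem_inf.mp (mk.le (Submodule.mem_map_of_mem x.2))).2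
  -- it maps the denominator of `H_(a+b)(J ← X)` into the denominator of `H_(b)(Ja ← X)`
  have hD : Submodule.comap (LinearMap.ker (Matrix.vecMulLinear
      (Matrix.of fun (v : {v : Fin k → Fin (e + 2) // (∑ i, (v i : ℕ)) + J = k * (e + 1)})
          (m : {m : Fin k → Fin (e + 2) // (∑ i, (m i : ℕ)) + (J + (a + b) * (e + 1)) = k * (e + 1)}) =>
        ((((List.flatMap (colR (e + 3)))^[a + b] [List.ofFn (fun i => (m.1 i : ℕ))]).count (List.ofFn (fun i => (v.1 i : ℕ))) : ℕ) : K)))).subtype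
        (LinearMap.range (Matrix.vecMulLinear
      (Matrix.of fun (v : {v : Fin k → Fin (e + 2) // (∑ i, (v i : ℕ)) + X = k * (e + 1)})
          (m : {m : Fin k → Fin (e + 2) // (∑ i, (m i : ℕ)) + J = k * (e + 1)}) =>
        ((((List.flatMap (colR (e + 3)))^[c] [List.ofFn (fun i => (m.1 i : ℕ))]).count (List.ofFn (fun i => (v.1 i : ℕ))) : ℕ) : K)))) ≤
      Submodule.comap (LinearMap.codRestrict (LinearMap.ker (Matrix.vecMulLinear
      (Matrix.of fun (v : {v : Fin k → Fin (e + 2) // (∑ i, (v i : ℕ)) + (J + a * (e + 1)) = k * (e + 1)})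
          (m : {m : Fin k → Fin (e + 2) // (∑ i, (m i : ℕ)) + (J + a * (e + 1) + b * (e + 1)) = k * (e + 1)}) =>
        ((((List.flatMap (colR (e + 3)))^[b] [List.ofFn (fun i => (m.1 i : ℕ))]).count (List.ofFn (fun i => (v.1 i : ℕ))) : ℕ) : K))))
        ((Matrix.vecMulLinear
      (Matrix.of fun (v : {v : Fin k → Fin (e + 2) // (∑ i, (v i : ℕ)) + J = k * (e + 1)})
          (m : {m : Fin k → Fin (e + 2) // (∑ i, (m i : ℕ)) + (J + a * (e + 1)) = k * (e + 1)}) =>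
        ((((List.flatMap (colR (e + 3)))^[a] [List.ofFn (fun i => (m.1 i : ℕ))]).count (List.ofFn (fun i => (v.1 i : ℕ))) : ℕ) : K))).comp
          (LinearMap.ker (Matrix.vecMulLinear
      (Matrix.of fun (v : {v : Fin k → Fin (e + 2) // (∑ i, (v i : ℕ)) + J = k * (e + 1)})
          (m : {m : Fin k → Fin (e + 2) // (∑ i, (m i : ℕ)) + (J + (a + b) * (e + 1)) = k * (e + 1)}) =>
        ((((List.flatMap (colR (e + 3)))^[a + b] [List.ofFn (fun i => (m.1 i : ℕ))]).count (List.ofFn (fun i => (v.1 i : ℕ))) : ℕ) : K)))).subtype) hf)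
      (Submodule.comap (LinearMap.ker (Matrix.vecMulLinear
      (Matrix.of fun (v : {v : Fin k → Fin (e + 2) // (∑ i, (v i : ℕ)) + (J + a * (e + 1)) = k * (e + 1)})
          (m : {m : Fin k → Fin (e + 2) // (∑ i, (m i : ℕ)) + (J + a * (e + 1) + b * (e + 1)) = k * (e + 1)}) =>
        ((((List.flatMap (colR (e + 3)))^[b] [List.ofFn (fun i => (m.1 i : ℕ))]).count (List.ofFn (fun i => (v.1 i : ℕ))) : ℕ) : K)))).subtype
        (LinearMap.range (Matrix.vecMulLinear
      (Matrix.of fun (v : {v : Fin k → Fin (e + 2) // (∑ i, (v i : ℕ)) + X = k * (e + 1)})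
          (m : {m : Fin k → Fin (e + 2) // (∑ i, (m i : ℕ)) + (J + a * (e + 1)) = k * (e + 1)}) =>
        ((((List.flatMap (colR (e + 3)))^[c + a] [List.ofFn (fun i => (m.1 i : ℕ))]).count (List.ofFn (fun i => (v.1 i : ℕ))) : ℕ) : K))))) := by
    intro x hx
    rw [Submodule.mem_comap, Submodule.mem_comap, Submodule.subtype_apply, LinearMap.codRestrict_apply, LinearMap.comp_apply, ← mr]
    exact Submodule.mem_map_of_mem (Submodule.mem_comap.mp hx)
  -- the induced map on the quotients: its kernel (EX-H1) and its range, then rank–nullity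
  have hk := Submodule.ker_mapQ _ _ _ hD
  rw [LinearMap.comap_codRestrict, Submodule.map_comap_subtype, inf_eq_right.mpr f4, Submodule.comap_comp,
    ← map_mkQ_ker_eq_map_mkQ_comap K p hp k e a b c X J habc] at hk
  have hr := Submodule.range_mapQ _ _ _ hD
  rw [LinearMap.range_codRestrict, LinearMap.range_comp, Submodule.range_subtype] at hr
  have rn := LinearMap.finrank_range_add_finrank_ker (Submodule.mapQ _ _ _ hD)
  have e1 := (LinearEquiv.ofEq _ _ hr).finrank_eq
  have e2 := (LinearEquiv.ofEq _ _ hk).finrank_eq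
  omega

end Summit.HodgeConjecture.HodgeConjecture.HodgeLocus.Census.UnitColumnHexagonExact
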